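import Literature.NumberTheory.Sieve.SmoothSaddleScaleCompare
import HarnessLib

/-!
# Minor arcs for sharp box-masked friable exponential sums — analytic tools for the eventual packaging

Topic `Literature/NumberTheory/Sieve`; a PROVED tool file (bookkeeping only) for `SmoothSharpMinorArcs.lean`,
the eventual form (tied `y = ⌊(log x)^{100000}⌋`) of the minor-arc bound for sharp friable boxes
`S(X,y) ∖ S(X',y)` with a dilation ([Harper2016, §5, Proposition 5]; explicit form in
`SmoothSharpMinorArcsLemmas.lean`).  With `𝓟(X) = X^{α} ζ(α,y)/√φ₂(α,y)`, `α = α(X,y)`: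

* `SharpMinor.card_le_sqrt_mul_saddleSize` — `Ψ(X,y) ≤ √(3 log X log y) 𝓟(X)` (Rankin at `α(X,y)` and
  `φ₂(α(X,y),y) ≤ 3 log X log y`, [HildebrandTenenbaum1986, Thm 2]);
* `SharpMinor.saddleSize_real_le` — `𝓟(X') ≤ C 𝓟(X)` for real `X/√X ≤ X' ≤ X` (the tree's `saddleSize_div_le`);
* `SharpMinor.junk_le` — the junk term `82(1+L)²y²x^{9/10}` of the pointwise minor-arc bound is at most
  `L^{28} (dL^B/R)^{49/100} 𝓟(X)` for boxes above `x/L^B` and `R ≤ x^{1/10}`;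
* `SharpMinor.combine_aux`, `regime_four_fifth`, `rpow_level_le`, `rpow_four_mul_le` — arithmetic.

## References

* A. J. Harper, Compositio Math. 152 (2016) 1121–1158, §5, Proposition 5 [Harper2016].
* A. Hildebrand, G. Tenenbaum, Trans. AMS 296 (1986), Thm 1–2 and §2 [HildebrandTenenbaum1986].
* H. L. Montgomery, R. C. Vaughan, *Multiplicative Number Theory I*, CUP 2007, §7.1 (7.17) [MontgomeryVaughan2007].
-/

noncomputable section

open Finset Filter Real

namespace Literature.NumberTheory.Sieve

namespace SharpMinor

/-! ### Small analytic helpers -/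

/-- **`Ψ(X, y) ≤ √(3 log X log y) · 𝓟(X)`** for large `X` with `(log X)³ ≤ y ≤ X`: Rankin's bound
`Ψ(X,y) ≤ X^α ζ(α,y)` at `α = α(X,y)` and the upper bound `φ₂(α(X,y), y) ≤ 3 log X log y`
(`saddlePhi₂_saddlePoint_le`). [cite: HildebrandTenenbaum1986, Thm 2 (2.5) and §2 (2.1)] -/
theorem card_le_sqrt_mul_saddleSize :
    ∃ x₀ : ℝ, ∀ (X : ℝ) (y : ℕ), x₀ ≤ X → Real.log X ^ 3 ≤ y → (y : ℝ) ≤ X →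
      ((Nat.smoothNumbersUpTo ⌊X⌋₊ (y + 1)).card : ℝ) ≤
        Real.sqrt (3 * Real.log X * Real.log y) *
          (X ^ saddlePoint X y *
            (smoothZeta (saddlePoint X y) y / Real.sqrt (saddlePhi₂ (saddlePoint X y) y))) := by
  obtain ⟨x₀, hφ⟩ := saddlePhi₂_saddlePoint_le
  refine ⟨max x₀ (Real.exp 2), fun X y hX hy3 hyX => ?_⟩
  have hx₀ : x₀ ≤ X := (le_max_left _ _).trans hX
  have hXe : Real.exp 2 ≤ X := (le_max_right _ _).trans hX
  have hX0 : 0 < X := lt_of_lt_of_le (Real.exp_pos 2) hXe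
  have hLX2 : 2 ≤ Real.log X := by rw [Real.le_log_iff_exp_le hX0]; exact hXe
  have hX1 : 1 < X := by
    have : (1 : ℝ) < Real.exp 2 := Real.one_lt_exp_iff.2 (by norm_num)
    linarith
  have hy8 : (8 : ℝ) ≤ y := by
    have : (2 : ℝ) ^ 3 ≤ Real.log X ^ 3 := pow_le_pow_left₀ (by norm_num) hLX2 3
    linarith
  have hy2 : 2 ≤ y := by exact_mod_cast (show (2 : ℝ) ≤ y by linarith)
  have hα0 : 0 < saddlePoint X y := saddlePoint_pos hX1 hy2
  have hφ0 : 0 < saddlePhi₂ (saddlePoint X y) y := saddlePhi₂_pos hy2 hα0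
  have hφle := hφ X y hx₀ hy3 hyX
  set M : ℝ := 3 * Real.log X * Real.log y with hM
  have hM0 : 0 < M := lt_of_lt_of_le hφ0 hφle
  have hζ0 : 0 < smoothZeta (saddlePoint X y) y := smoothZeta_pos hα0
  have hR := card_smoothNumbersUpTo_floor_le_rankin (z := X) hX0.le hα0 y
  have hsq : Real.sqrt (saddlePhi₂ (saddlePoint X y) y) ≤ Real.sqrt M := Real.sqrt_le_sqrt hφle
  have hsq0 : 0 < Real.sqrt (saddlePhi₂ (saddlePoint X y) y) := Real.sqrt_pos.2 hφ0
  have hsqM : 0 < Real.sqrt M := Real.sqrt_pos.2 hM0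
  calc ((Nat.smoothNumbersUpTo ⌊X⌋₊ (y + 1)).card : ℝ)
      ≤ X ^ saddlePoint X y * smoothZeta (saddlePoint X y) y := hR
    _ = Real.sqrt M * (X ^ saddlePoint X y * (smoothZeta (saddlePoint X y) y / Real.sqrt M)) := by
        field_simp
    _ ≤ Real.sqrt M * (X ^ saddlePoint X y *
          (smoothZeta (saddlePoint X y) y / Real.sqrt (saddlePhi₂ (saddlePoint X y) y))) := by
        gcongr

/-- **Saddle sizes at nearby real scales**: `𝓟(X') ≤ C 𝓟(X)` for `X/√X ≤ X' ≤ X` (`X ≥ x₀`, `(log X)⁴ ≤ y`,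
`log y ≤ (log X)^{1/5}`), from the tree's `saddleSize_div_le` with the real divisor `g = X/X' ∈ [1, √X]` and
`g^{−α(X,y)} ≤ 1`. [cite: HildebrandTenenbaum1986, §2 (2.1)–(2.2) and Thm 2 (2.5)] -/
theorem saddleSize_real_le :
    ∃ C x₀ : ℝ, 0 < C ∧ ∀ (X X' : ℝ) (y : ℕ), x₀ ≤ X → Real.log X ^ 4 ≤ y →
      Real.log y ≤ Real.log X ^ (1 / 5 : ℝ) → 0 < X' → X' ≤ X → X ≤ X' * X ^ (1 / 2 : ℝ) →
      X' ^ saddlePoint X' y *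
          (smoothZeta (saddlePoint X' y) y / Real.sqrt (saddlePhi₂ (saddlePoint X' y) y)) ≤
        C * (X ^ saddlePoint X y *
          (smoothZeta (saddlePoint X y) y / Real.sqrt (saddlePhi₂ (saddlePoint X y) y))) := by
  obtain ⟨C, x₀, hC, hP⟩ := saddleSize_div_le
  refine ⟨C, max x₀ (Real.exp 2), hC, fun X X' y hX hy4 hy5 hX'0 hX'X hXX' => ?_⟩
  have hx₀ : x₀ ≤ X := (le_max_left _ _).trans hX
  have hXe : Real.exp 2 ≤ X := (le_max_right _ _).trans hX
  have hX0 : 0 < X := lt_of_lt_of_le (Real.exp_pos 2) hXe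
  have hLX2 : 2 ≤ Real.log X := by rw [Real.le_log_iff_exp_le hX0]; exact hXe
  have hX1 : 1 < X := by
    have : (1 : ℝ) < Real.exp 2 := Real.one_lt_exp_iff.2 (by norm_num)
    linarith
  have hy16 : (16 : ℝ) ≤ y := by
    have : (2 : ℝ) ^ 4 ≤ Real.log X ^ 4 := pow_le_pow_left₀ (by norm_num) hLX2 4
    linarith
  have hy2 : 2 ≤ y := by exact_mod_cast (show (2 : ℝ) ≤ y by linarith)
  have hα0 : 0 < saddlePoint X y := saddlePoint_pos hX1 hy2
  set g : ℝ := X / X' with hg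
  have hg1 : 1 ≤ g := by rw [hg, le_div_iff₀ hX'0, one_mul]; exact hX'X
  have hgle : g ≤ X ^ (1 / 2 : ℝ) := by rw [hg, div_le_iff₀ hX'0]; linarith
  have h := hP X y hx₀ hy4 hy5 g hg1 hgle
  have hXg : X / g = X' := by rw [hg]; field_simp
  rw [hXg] at h
  have hgα : g ^ (-saddlePoint X y) ≤ 1 := Real.rpow_le_one_of_one_le_of_nonpos hg1 (by linarith)
  have hP0 : 0 ≤ X ^ saddlePoint X y * smoothZeta (saddlePoint X y) y /
      Real.sqrt (saddlePhi₂ (saddlePoint X y) y) := by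
    have := smoothZeta_pos (y := y) hα0
    positivity
  rw [mul_div_assoc, mul_div_assoc] at h
  rw [mul_div_assoc] at hP0
  calc _ ≤ C * g ^ (-saddlePoint X y) * (X ^ saddlePoint X y *
          (smoothZeta (saddlePoint X y) y / Real.sqrt (saddlePhi₂ (saddlePoint X y) y))) := h
    _ ≤ C * 1 * (X ^ saddlePoint X y *
          (smoothZeta (saddlePoint X y) y / Real.sqrt (saddlePhi₂ (saddlePoint X y) y))) := by
        gcongr
    _ = _ := by rw [mul_one]

/-- **The junk term is negligible.**  With `L = log x ≥ 1`, `y ≤ L^{100000}`, `s = dL^B/R ≤ 1`, `R ≤ x^{1/10}`,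
a box scale `X ≥ x/L^B` with `Ψ(X, y) ≥ X^{39999/40000}` and `Ψ(X,y) ≤ √(3 log X log y) 𝓟` (`log X, log y ≤ L`),
and `656 L^{200002+B} ≤ x^{1999/40000}`: `82 (1+L)² y² x^{9/10} ≤ L³ L^{25} s^{49/100} 𝓟`
(`s^{49/100} ≥ s^{1/2} ≥ x^{−1/20}`, `𝓟 ≥ X^{39999/40000}/(2L) ≥ x^{39999/40000}/(2 L^{B+1})`). [folklore] -/
theorem junk_le {x L X s P Ψ R : ℝ} {y d B : ℕ} (hx : 1 ≤ x) (hL : 1 ≤ L) (hyK : (y : ℝ) ≤ L ^ 100000)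
    (hd : 1 ≤ d) (hs : s = d * L ^ B / R) (hR0 : 0 < R) (hRx : R ≤ x ^ (1 / 10 : ℝ)) (hs1 : s ≤ 1)
    (hX1 : 1 ≤ X) (hX : x / L ^ B ≤ X) (hΨ : X ^ ((39999 : ℝ) / 40000) ≤ Ψ)
    (hΨP : Ψ ≤ Real.sqrt (3 * Real.log X * Real.log y) * P)
    (hLX : Real.log X ≤ L) (hlogy0 : 0 ≤ Real.log y) (hlogy : Real.log y ≤ L) (hP : 0 ≤ P)
    (hE : 656 * L ^ (200002 + B) ≤ x ^ ((1999 : ℝ) / 40000)) :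
    82 * (1 + L) ^ 2 * (y : ℝ) ^ 2 * x ^ (9 / 10 : ℝ) ≤ L ^ 3 * L ^ 25 * s ^ (49 / 100 : ℝ) * P := by
  have hx0 : 0 < x := by linarith
  have hL0 : 0 < L := by linarith
  have hLB : 1 ≤ L ^ B := one_le_pow₀ hL
  have hLB0 : 0 < L ^ B := by positivity
  have hd1 : (1 : ℝ) ≤ d := by exact_mod_cast hd
  have hX0 : 0 < X := by linarith
  have hLX0 : 0 ≤ Real.log X := Real.log_nonneg hX1
  have hy0 : (0 : ℝ) ≤ y := Nat.cast_nonneg _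
  -- `s ≥ x^{-1/10}` and `s^{49/100} ≥ x^{-1/20}`
  have hs0 : 0 < s := by rw [hs]; positivity
  have hslow : x ^ (-(1 / 10 : ℝ)) ≤ s := by
    rw [hs, Real.rpow_neg hx0.le, le_div_iff₀ hR0]
    calc (x ^ (1 / 10 : ℝ))⁻¹ * R ≤ (x ^ (1 / 10 : ℝ))⁻¹ * x ^ (1 / 10 : ℝ) := by gcongr
      _ = 1 := inv_mul_cancel₀ (by positivity)
      _ ≤ d * L ^ B := one_le_mul_of_one_le_of_one_le hd1 hLB
  have hsa : x ^ (-(1 / 20 : ℝ)) ≤ s ^ (49 / 100 : ℝ) := by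
    have h1 : s ^ (1 / 2 : ℝ) ≤ s ^ (49 / 100 : ℝ) :=
      Real.rpow_le_rpow_of_exponent_ge hs0 hs1 (by norm_num)
    have h2 : (x ^ (-(1 / 10 : ℝ))) ^ (1 / 2 : ℝ) ≤ s ^ (1 / 2 : ℝ) :=
      Real.rpow_le_rpow (Real.rpow_nonneg hx0.le _) hslow (by norm_num)
    have h3 : (x ^ (-(1 / 10 : ℝ))) ^ (1 / 2 : ℝ) = x ^ (-(1 / 20 : ℝ)) := by
      rw [← Real.rpow_mul hx0.le]; norm_num
    linarith
  -- `X^{θ} ≤ 2 L P`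
  have hsqrt : Real.sqrt (3 * Real.log X * Real.log y) ≤ 2 * L := by
    rw [Real.sqrt_le_left (by positivity)]
    nlinarith [mul_le_mul hLX hlogy hlogy0 hL0.le]
  have hXP : X ^ ((39999 : ℝ) / 40000) ≤ 2 * L * P :=
    hΨ.trans (hΨP.trans (mul_le_mul_of_nonneg_right hsqrt hP))
  -- `x^{θ} ≤ L^B X^{θ}`
  have hxX : x ^ ((39999 : ℝ) / 40000) ≤ L ^ B * X ^ ((39999 : ℝ) / 40000) := by
    have h1 : x ≤ L ^ B * X := by rw [div_le_iff₀ hLB0] at hX; linarith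
    have h2 : x ^ ((39999 : ℝ) / 40000) ≤ (L ^ B * X) ^ ((39999 : ℝ) / 40000) :=
      Real.rpow_le_rpow hx0.le h1 (by norm_num)
    have h3 : (L ^ B * X) ^ ((39999 : ℝ) / 40000) = (L ^ B) ^ ((39999 : ℝ) / 40000) * X ^ ((39999 : ℝ) / 40000) :=
      Real.mul_rpow hLB0.le hX0.le
    have h4 : (L ^ B) ^ ((39999 : ℝ) / 40000) ≤ L ^ B := by
      calc (L ^ B) ^ ((39999 : ℝ) / 40000) ≤ (L ^ B) ^ (1 : ℝ) :=
            Real.rpow_le_rpow_of_exponent_le hLB (by norm_num)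
        _ = L ^ B := Real.rpow_one _
    calc x ^ ((39999 : ℝ) / 40000) ≤ (L ^ B) ^ ((39999 : ℝ) / 40000) * X ^ ((39999 : ℝ) / 40000) := h3 ▸ h2
      _ ≤ L ^ B * X ^ ((39999 : ℝ) / 40000) := by gcongr
  -- assemble: `656 L^{2K+2+B} x^{9/10} ≤ x^{θ - 1/20} ≤ 2 L^{B+1} s^a P`
  have hmain : 656 * L ^ (200002 + B) * x ^ (9 / 10 : ℝ) ≤ 2 * L ^ B * L * (s ^ (49 / 100 : ℝ) * P) := by
    have h1 : 656 * L ^ (200002 + B) * x ^ (9 / 10 : ℝ) ≤ x ^ ((1999 : ℝ) / 40000) * x ^ (9 / 10 : ℝ) :=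
      mul_le_mul_of_nonneg_right hE (Real.rpow_nonneg hx0.le _)
    have h2 : x ^ ((1999 : ℝ) / 40000) * x ^ (9 / 10 : ℝ) = x ^ ((39999 : ℝ) / 40000) * x ^ (-(1 / 20 : ℝ)) := by
      rw [← Real.rpow_add hx0, ← Real.rpow_add hx0]; norm_num
    have h3 : x ^ ((39999 : ℝ) / 40000) * x ^ (-(1 / 20 : ℝ)) ≤ (L ^ B * (2 * L * P)) * s ^ (49 / 100 : ℝ) :=
      mul_le_mul (hxX.trans (mul_le_mul_of_nonneg_left hXP hLB0.le)) hsa (Real.rpow_nonneg hx0.le _)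
        (by positivity)
    calc 656 * L ^ (200002 + B) * x ^ (9 / 10 : ℝ) ≤ x ^ ((39999 : ℝ) / 40000) * x ^ (-(1 / 20 : ℝ)) := h2 ▸ h1
      _ ≤ (L ^ B * (2 * L * P)) * s ^ (49 / 100 : ℝ) := h3
      _ = 2 * L ^ B * L * (s ^ (49 / 100 : ℝ) * P) := by ring
  -- the left-hand side
  have hsP : 0 ≤ s ^ (49 / 100 : ℝ) * P := mul_nonneg (Real.rpow_nonneg hs0.le _) hP
  have hy2 : (y : ℝ) ^ 2 ≤ (L ^ 100000) ^ 2 := pow_le_pow_left₀ hy0 hyK 2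
  have hlhs : 82 * (1 + L) ^ 2 * (y : ℝ) ^ 2 * x ^ (9 / 10 : ℝ) ≤ 328 * L ^ 200002 * x ^ (9 / 10 : ℝ) := by
    have h1 : (1 + L) ^ 2 ≤ (2 * L) ^ 2 := pow_le_pow_left₀ (by linarith) (by linarith) 2
    have hx9 : 0 ≤ x ^ (9 / 10 : ℝ) := Real.rpow_nonneg hx0.le _
    calc 82 * (1 + L) ^ 2 * (y : ℝ) ^ 2 * x ^ (9 / 10 : ℝ) ≤ 82 * (2 * L) ^ 2 * (L ^ 100000) ^ 2 * x ^ (9 / 10 : ℝ) := by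
          gcongr
      _ = 328 * L ^ 200002 * x ^ (9 / 10 : ℝ) := by ring
  -- divide `hmain` by `2 L^B`
  have hkey : 328 * L ^ 200002 * x ^ (9 / 10 : ℝ) ≤ L * (s ^ (49 / 100 : ℝ) * P) := by
    have h1 : L ^ (200002 + B) = L ^ 200002 * L ^ B := pow_add _ _ _
    rw [h1] at hmain
    have h2 : L ^ B * (2 * (328 * L ^ 200002 * x ^ (9 / 10 : ℝ))) ≤ L ^ B * (2 * (L * (s ^ (49 / 100 : ℝ) * P))) := by
      calc L ^ B * (2 * (328 * L ^ 200002 * x ^ (9 / 10 : ℝ))) = 656 * (L ^ 200002 * L ^ B) * x ^ (9 / 10 : ℝ) := by ring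
        _ ≤ 2 * L ^ B * L * (s ^ (49 / 100 : ℝ) * P) := hmain
        _ = L ^ B * (2 * (L * (s ^ (49 / 100 : ℝ) * P))) := by ring
    have h3 := le_of_mul_le_mul_left h2 hLB0
    linarith
  have hL28 : L * (s ^ (49 / 100 : ℝ) * P) ≤ L ^ 3 * L ^ 25 * s ^ (49 / 100 : ℝ) * P := by
    have h1 : L ≤ L ^ 3 * L ^ 25 := by
      calc L = L ^ 1 := (pow_one _).symm
        _ ≤ L ^ 28 := pow_le_pow_right₀ hL (by norm_num)
        _ = L ^ 3 * L ^ 25 := by rw [← pow_add]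
    calc L * (s ^ (49 / 100 : ℝ) * P) ≤ (L ^ 3 * L ^ 25) * (s ^ (49 / 100 : ℝ) * P) :=
          mul_le_mul_of_nonneg_right h1 hsP
      _ = _ := by ring
  exact hlhs.trans (hkey.trans hL28)

/-- Bookkeeping for the eventual packaging: the plain box bound `C₁ L₃ Y S (P + P') + J` and the even-part
bound `C₁ L₃ Y S₄ (P₂ + P₂') + J` add up to at most `(C₁ + 5 C₁ C₂ + 2) L₃ L₂₅ S P` once `Y ≤ L₂₅`,
`S₄ ≤ 2S`, the three auxiliary saddle sizes are `≤ C₂ P` and the junk `J ≤ L₃ L₂₅ S P`. [folklore] -/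
theorem combine_aux {C₁ C₂ L₃ L₂₅ Y S S₄ P P' P₂ P₂' J : ℝ} (hC₁ : 0 ≤ C₁) (hL₃ : 0 ≤ L₃)
    (hY0 : 0 ≤ Y) (hS : 0 ≤ S) (hP : 0 ≤ P) (hP' : 0 ≤ P') (hP₂ : 0 ≤ P₂) (hP₂' : 0 ≤ P₂')
    (hY : Y ≤ L₂₅) (hS₄ : S₄ ≤ 2 * S) (h₁ : P' ≤ C₂ * P) (h₂ : P₂ ≤ C₂ * P) (h₃ : P₂' ≤ C₂ * P)
    (hJ : J ≤ L₃ * L₂₅ * S * P) :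
    C₁ * L₃ * Y * S * (P + P') + J + (C₁ * L₃ * Y * S₄ * (P₂ + P₂') + J) ≤
      (C₁ + 5 * C₁ * C₂ + 2) * (L₃ * L₂₅) * S * P := by
  have hA : C₁ * L₃ * Y * S * (P + P') ≤ C₁ * L₃ * L₂₅ * S * (P + C₂ * P) := by
    have h0 : 0 ≤ C₁ * L₃ := mul_nonneg hC₁ hL₃
    calc C₁ * L₃ * Y * S * (P + P') = C₁ * L₃ * (Y * (S * (P + P'))) := by ring
      _ ≤ C₁ * L₃ * (L₂₅ * (S * (P + C₂ * P))) := by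
          apply mul_le_mul_of_nonneg_left _ h0
          apply mul_le_mul hY _ (by positivity) (hY0.trans hY)
          exact mul_le_mul_of_nonneg_left (by linarith) hS
      _ = _ := by ring
  have hB : C₁ * L₃ * Y * S₄ * (P₂ + P₂') ≤ C₁ * L₃ * L₂₅ * (2 * S) * (C₂ * P + C₂ * P) := by
    have h0 : 0 ≤ C₁ * L₃ := mul_nonneg hC₁ hL₃
    have hPP : 0 ≤ P₂ + P₂' := add_nonneg hP₂ hP₂'
    calc C₁ * L₃ * Y * S₄ * (P₂ + P₂') = C₁ * L₃ * (Y * (S₄ * (P₂ + P₂'))) := by ring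
      _ ≤ C₁ * L₃ * (L₂₅ * (2 * S * (C₂ * P + C₂ * P))) := by
          apply mul_le_mul_of_nonneg_left _ h0
          have hS₄PP : S₄ * (P₂ + P₂') ≤ 2 * S * (P₂ + P₂') := mul_le_mul_of_nonneg_right hS₄ hPP
          have h2S : 2 * S * (P₂ + P₂') ≤ 2 * S * (C₂ * P + C₂ * P) :=
            mul_le_mul_of_nonneg_left (add_le_add h₂ h₃) (by positivity)
          have hYS : Y * (S₄ * (P₂ + P₂')) ≤ Y * (2 * S * (C₂ * P + C₂ * P)) :=
            mul_le_mul_of_nonneg_left (hS₄PP.trans h2S) hY0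
          refine hYS.trans (mul_le_mul_of_nonneg_right hY ?_)
          exact mul_nonneg (by positivity) (add_nonneg (hP₂.trans h₂) (hP₂.trans h₂))
      _ = _ := by ring
  nlinarith [hA, hB, hJ, mul_nonneg (mul_nonneg hC₁ hL₃) (mul_nonneg (hY0.trans hY) (mul_nonneg hS hP))]

/-! ### Regime bookkeeping at a box scale -/

/-- From the polylog-regime facts at a scale `Z ≥ e` (`(log Z)⁸ ≤ y`, `log y ≤ ½ (log Z)^{1/6}`) to the
hypotheses of `saddleSize_real_le` (`(log Z)⁴ ≤ y`, `log y ≤ (log Z)^{1/5}`). [folklore] -/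
theorem regime_four_fifth {Z : ℝ} {y : ℕ} (hZ : Real.exp 1 ≤ Z) (h8 : Real.log Z ^ 8 ≤ y)
    (h6 : Real.log y ≤ 1 / 2 * Real.log Z ^ (1 / 6 : ℝ)) :
    Real.log Z ^ 4 ≤ y ∧ Real.log y ≤ Real.log Z ^ (1 / 5 : ℝ) := by
  have hZ0 : 0 < Z := lt_of_lt_of_le (Real.exp_pos 1) hZ
  have hL1 : 1 ≤ Real.log Z := by rw [Real.le_log_iff_exp_le hZ0]; exact hZ
  refine ⟨le_trans (pow_le_pow_right₀ hL1 (by norm_num)) h8, h6.trans ?_⟩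
  have h1 : Real.log Z ^ (1 / 6 : ℝ) ≤ Real.log Z ^ (1 / 5 : ℝ) :=
    Real.rpow_le_rpow_of_exponent_le hL1 (by norm_num)
  have h2 : 0 ≤ Real.log Z ^ (1 / 6 : ℝ) := Real.rpow_nonneg (by linarith) _
  linarith

/-- `y^{1/4000} ≤ L^{25}` when `0 ≤ y ≤ L^{100000}`, `L ≥ 0`. [folklore] -/
theorem rpow_level_le {Y L : ℝ} (hY0 : 0 ≤ Y) (hL : 0 ≤ L) (hY : Y ≤ L ^ 100000) :
    Y ^ (1 / 4000 : ℝ) ≤ L ^ 25 := by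
  have h1 : Y ^ (1 / 4000 : ℝ) ≤ (L ^ 100000) ^ (1 / 4000 : ℝ) := Real.rpow_le_rpow hY0 hY (by norm_num)
  have h2 : (L ^ 100000) ^ (1 / 4000 : ℝ) = L ^ 25 := by
    rw [show L ^ 100000 = (L ^ 25) ^ 4000 by rw [← pow_mul],
      show (1 / 4000 : ℝ) = ((4000 : ℕ) : ℝ)⁻¹ by norm_num,
      Real.pow_rpow_inv_natCast (pow_nonneg hL _) (by norm_num)]
  rw [← h2]; exact h1

/-- `(4s)^{49/100} ≤ 2 s^{49/100}` for `s ≥ 0` (`4^{49/100} ≤ 4^{1/2} = 2`). [folklore] -/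
theorem rpow_four_mul_le {s : ℝ} (hs : 0 ≤ s) : (4 * s) ^ (49 / 100 : ℝ) ≤ 2 * s ^ (49 / 100 : ℝ) := by
  rw [Real.mul_rpow (by norm_num) hs]
  refine mul_le_mul_of_nonneg_right ?_ (Real.rpow_nonneg hs _)
  calc (4 : ℝ) ^ (49 / 100 : ℝ) ≤ (4 : ℝ) ^ (1 / 2 : ℝ) :=
        Real.rpow_le_rpow_of_exponent_le (by norm_num) (by norm_num)
    _ = 2 := by
        rw [show (4 : ℝ) = 2 ^ (2 : ℕ) by norm_num, ← Real.rpow_natCast, ← Real.rpow_mul (by norm_num)]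
        norm_num

end SharpMinor

end Literature.NumberTheory.Sieve

end
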